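import Literature.Computability.MetaComplexity.LinearMapResolutionWidth
import Literature.Computability.MetaComplexity.ResolutionExpansionWidth
import Literature.Computability.MetaComplexity.XorificationLift
import HarnessLib

/-!
# Proof of Krajíček 2019, Lemma 13.4.5 (resolution width of the XOR-CNF of an expanding linear map)

Discharges the named fact `Krajicek2019_lemma_13_4_5` of `LinearMapResolutionWidth.lean`
(`theorem Krajicek2019_lemma_13_4_5_holds`): for natural numbers `ℓ ≥ 1`, `r ≥ 1` and a system
`E` of `m` linear equations over `𝔽₂` in `n` unknowns whose row supports form an
`(r, 3/4 · ℓ)`-boundary expander, every resolution refutation `π` of the XOR-CNF `sumEncoding 1 E`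
has `resWidth π ≥ r/4`.

## The printed proof and the road taken here

Krajíček (*Proof Complexity*, CUP 2019, p. 273) proves Lemma 13.4.5 by a prover–adversary walk
from the empty end-clause of `π` back to an initial clause, maintaining *safe partial solutions*
`α_t` (safe sets of rows, Lemma 13.3.2; extension of safe solutions, Lemma 13.4.4, which uses the
`(r, 1/4)`-expansion of the residual matrix `A_I`) with `|supp α_t| ≤ 2w`, and reaches a
contradiction at the initial clause as long as `w < r/4`.

The tree already contains the Ben-Sasson–Wigderson width method (`ResolutionWidth.lean`:
`ResDerivable`, `resDerivable_restrict_of_isResRefutation`; `ResolutionExpansionWidth.lean`: the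
clause-level "expansion ⇒ width" invariant; `ScopeExpansion.lean`: `boundary`,
`IsBoundaryExpander`), so — DEVIATION FROM PRINT, same statement — we discharge the fact by the
standard Ben-Sasson–Wigderson argument for linear equations over `𝔽₂` (Ben-Sasson–Wigderson 2001,
§4.2 for Tseitin = mod-2 equations, §5, Thm 5.9 / Thm 6.5), run at the level of ROWS of the system
rather than clauses of the CNF (all `2^{|J_i|-1}` clauses of a row share the scope `J_i`, so the
clause-level scope family is never a boundary expander and
`not_resDerivable_empty_of_isBoundaryExpander` does not apply verbatim):

* the semantic measure is `μ(C) = min {|I| : the equations of the rows i ∈ I imply C}`; axioms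
  have `μ ≤ 1` (`exists_row_implies_of_mem_clauseSet`), resolvents are implied by the union;
* flipping a boundary variable `x_j`, `j ∈ ∂I` owned by the row `i`, repairs the parity of row
  `i` and touches no other row of `I` (`exists_flip_row`; the coefficient of `x_j` in row `i` is
  `1`); hence every set of `≤ r` rows of an `(r, c)`-boundary expander (`c > 0`) is satisfiable
  (`exists_rows_hold_of_card_le`) and a minimal implying set has its boundary inside the implied
  clause (`boundary_subset_clauseVars_of_row_minimal`);
* the invariant (`exists_rows_imply_of_resDerivable`): in width `w < c r / 2` every derivable
  clause is implied by at most `r/2` rows; so the empty clause is not derivable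
  (`not_resDerivable_empty_of_rows`), i.e. `w ≥ c r / 2 = 3 ℓ r / 8 ≥ r / 4` for `c = 3ℓ/4`,
  `ℓ ≥ 1`, `r ≥ 2`; for `r = 1` the bound `1/4` only needs `w ≥ 1`, i.e. that the empty clause is
  not an initial clause, which expansion at a single row gives
  (`empty_notMem_clauseSet_of_expander`).

This yields the printed bound `r/4` (indeed `3ℓr/8`); `ℓ`-sparsity and `b̄ ∉ rng(A)` are not
used (the latter only guarantees that refutations exist at all).

## References

* J. Krajíček, *Proof Complexity*, Encyclopedia Math. Appl. 170, CUP 2019, §13.3 (p. 267: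
  boundary, `(r, ε)`-expanders), §13.4 (p. 272: `τ_b̄(A)`; p. 273: Lemma 13.4.5 and its proof).
  [KrajicekProofComplexity2019]
* E. Ben-Sasson, A. Wigderson, *Short proofs are narrow — resolution made simple*, J. ACM 48
  (2001) 149–169, §4.2 (Tseitin formulas), §5 (Def. 5.1, Lemma 5.7, Thm 5.9), Thm 6.5.
  [BenSassonWigderson2001]
-/

namespace Literature.Computability.MetaComplexity

open Finset Literature.Computability.Complexity

/-! ### Arithmetic in `𝔽₂` and the `B = 1` sum-encoding -/

/-- In `𝔽₂`, `s ≠ t` forces `s + 1 = t`. [folklore] -/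
theorem zmod_two_add_one_eq_of_ne {s t : ZMod 2} (h : s ≠ t) : s + 1 = t := by
  revert s t; decide

/-- Under the `B = 1` sum-encoding the `𝔽₂`-value of the unknown `y_j` is the Boolean variable
`x_j` itself (the block of `j` is the single variable `j`). [folklore] -/
theorem blockVals_two_one_apply (n : ℕ) (σ : ℕ → Bool) (j : Fin n) :
    blockVals 2 1 n σ j = if σ j then 1 else 0 := by
  have hblock : encBlock 1 (j : ℕ) = [(j : ℕ)] := by
    rw [show (1 : ℕ) = 0 + 1 from rfl]
    simp [xorBlock, List.range_succ]
  simp only [blockVals, blockVal, hblock]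
  by_cases h : σ j <;> simp [h]

/-- Updating the Boolean variable `x_j` updates the unknown `y_j` (`B = 1`). [folklore] -/
theorem blockVals_two_one_update {n : ℕ} (σ : ℕ → Bool) (j : Fin n) (b : Bool) :
    blockVals 2 1 n (Function.update σ j b) =
      Function.update (blockVals 2 1 n σ) j (if b then 1 else 0) := by
  funext j'
  by_cases h : j' = j
  · subst h
    rw [Function.update_self, blockVals_two_one_apply, Function.update_self]
  · rw [Function.update_of_ne h, blockVals_two_one_apply, blockVals_two_one_apply,
      Function.update_of_ne (Fin.val_injective.ne h)]

/-- Only the support of an equation matters: `∑_j a_j z_j = ∑_{j ∈ supp} a_j z_j`. [folklore] -/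
theorem LinEqMod.sum_eq_sum_supp {p n : ℕ} (E : LinEqMod p n) (z : Fin n → ZMod p) :
    ∑ j, E.1 j * z j = ∑ j ∈ E.supp, E.1 j * z j := by
  symm
  exact Finset.sum_subset (Finset.subset_univ _) fun j _ hj => by
    have : E.1 j = 0 := by simpa [LinEqMod.supp] using hj
    rw [this, zero_mul]

/-- The value of an equation is unchanged by modifying unknowns outside its support. [folklore] -/
theorem LinEqMod.holds_congr_supp {p n : ℕ} (E : LinEqMod p n) {z z' : Fin n → ZMod p}
    (h : ∀ j ∈ E.supp, z j = z' j) : E.Holds z ↔ E.Holds z' := by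
  unfold LinEqMod.Holds
  rw [E.sum_eq_sum_supp z, E.sum_eq_sum_supp z',
    Finset.sum_congr rfl fun j hj => by rw [h j hj]]

/-- Over `𝔽₂`, adding `1` to an unknown in the support of a violated equation repairs it (the
coefficient is `1`). [Ben-Sasson–Wigderson 2001, §4.2 (mod-2 equations)] [folklore] -/
theorem LinEqMod.holds_update_add_one {n : ℕ} (E : LinEqMod 2 n) {z : Fin n → ZMod 2}
    {j : Fin n} (hj : j ∈ E.supp) (hz : ¬ E.Holds z) :
    E.Holds (Function.update z j (z j + 1)) := by
  unfold LinEqMod.Holds at hz ⊢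
  rw [← Finset.add_sum_erase _ _ (Finset.mem_univ j)] at hz ⊢
  have hrest : ∑ j' ∈ univ.erase j, E.1 j' * Function.update z j (z j + 1) j' =
      ∑ j' ∈ univ.erase j, E.1 j' * z j' :=
    Finset.sum_congr rfl fun j' hj' => by rw [Function.update_of_ne (Finset.ne_of_mem_erase hj')]
  rw [hrest, Function.update_self]
  have ha : E.1 j = 1 :=
    (by decide : ∀ a : ZMod 2, a ≠ 0 → a = 1) _ (by simpa [LinEqMod.supp] using hj)
  rw [ha, one_mul] at hz ⊢
  rw [add_right_comm]
  exact zmod_two_add_one_eq_of_ne hz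

/-- Rows not containing `x` keep their value when the Boolean variable `x` is changed. [folklore] -/
theorem holds_blockVals_update_iff {n : ℕ} (E₀ : LinEqMod 2 n) (σ : ℕ → Bool) {x : ℕ} (b : Bool)
    (hx : ∀ j ∈ E₀.supp, (j : ℕ) ≠ x) :
    E₀.Holds (blockVals 2 1 n (Function.update σ x b)) ↔ E₀.Holds (blockVals 2 1 n σ) :=
  E₀.holds_congr_supp fun j hj => by
    rw [blockVals_two_one_apply, blockVals_two_one_apply, Function.update_of_ne (hx j hj)]

/-- Flipping `x_j`, `j ∈ supp E₀`, repairs a violated equation `E₀` (`B = 1` encoding over `𝔽₂`).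
[Ben-Sasson–Wigderson 2001, §4.2] [folklore] -/
theorem holds_blockVals_update_not {n : ℕ} (E₀ : LinEqMod 2 n) (σ : ℕ → Bool) {j : Fin n}
    (hj : j ∈ E₀.supp) (h : ¬ E₀.Holds (blockVals 2 1 n σ)) :
    E₀.Holds (blockVals 2 1 n (Function.update σ j (!σ j))) := by
  rw [blockVals_two_one_update]
  have hval : (if (!σ j) = true then (1 : ZMod 2) else 0) = blockVals 2 1 n σ j + 1 := by
    rw [blockVals_two_one_apply]
    cases σ j <;> decide
  rw [hval]
  exact E₀.holds_update_add_one hj h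

/-! ### Rows, boundaries and flips -/

/-- A boundary point of a family `I` of rows is a variable `x_j` with `j` in the support of exactly
one row of `I`. [Krajíček 2019, §13.3 (boundary `∂_A(I)`)] [folklore] -/
theorem exists_unique_row_of_mem_boundary {n m : ℕ} (E : Fin m → LinEqMod 2 n) {I : Finset (Fin m)}
    {x : ℕ} (hx : x ∈ boundary (fun i => (E i).supp.map Fin.valEmbedding) I) :
    ∃ i ∈ I, ∃ j : Fin n, (j : ℕ) = x ∧ j ∈ (E i).supp ∧ ∀ i' ∈ I, j ∈ (E i').supp → i' = i := by
  obtain ⟨i, ⟨hi, hxi⟩, huniq⟩ := existsUnique_of_mem_boundary hx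
  obtain ⟨j, hj, rfl⟩ := mem_map.1 hxi
  exact ⟨i, hi, j, rfl, hj, fun i' hi' hji' => huniq i' ⟨hi', mem_map.2 ⟨j, hji', rfl⟩⟩⟩

/-- **Flipping a boundary variable** (BSW Lemma 5.7 for parity constraints). If `j` lies in the
support of row `i` and of no other row of `I`, then any assignment satisfying the other rows of
`I` can be changed at `x_j` alone so as to satisfy all rows of `I`; clauses not mentioning `x_j`
keep their value. [cite: BenSassonWigderson2001, Lemma 5.7] -/
theorem exists_flip_row {n m : ℕ} (E : Fin m → LinEqMod 2 n) {I : Finset (Fin m)} {i : Fin m}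
    {j : Fin n} (hji : j ∈ (E i).supp) (huniq : ∀ i' ∈ I, j ∈ (E i').supp → i' = i)
    {σ : ℕ → Bool} (hσ : ∀ i' ∈ I.erase i, (E i').Holds (blockVals 2 1 n σ)) :
    ∃ b : Bool, (∀ i' ∈ I, (E i').Holds (blockVals 2 1 n (Function.update σ j b))) ∧
      ∀ C : Finset (Literal ℕ), (j : ℕ) ∉ clauseVars C →
        (finsetClauseEval (Function.update σ j b) C ↔ finsetClauseEval σ C) := by
  have hkeep : ∀ (b : Bool) (C : Finset (Literal ℕ)), (j : ℕ) ∉ clauseVars C →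
      (finsetClauseEval (Function.update σ j b) C ↔ finsetClauseEval σ C) := fun b C hjC =>
    finsetClauseEval_update_iff (fun l hl hlx => hjC (mem_clauseVars_iff.2 ⟨l, hl, hlx⟩)) _
  have hothers : ∀ (b : Bool), ∀ i' ∈ I, i' ≠ i →
      (E i').Holds (blockVals 2 1 n (Function.update σ j b)) := by
    intro b i' hi' hne
    have hj' : ∀ j' ∈ (E i').supp, (j' : ℕ) ≠ j := by
      intro j' hj' heq
      obtain rfl : j' = j := Fin.ext heq
      exact hne (huniq i' hi' hj')
    exact (holds_blockVals_update_iff (E i') σ b hj').2 (hσ i' (Finset.mem_erase.2 ⟨hne, hi'⟩))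
  by_cases hi : (E i).Holds (blockVals 2 1 n σ)
  · refine ⟨σ j, fun i' hi' => ?_, hkeep _⟩
    rw [Function.update_eq_self]
    by_cases hne : i' = i
    · subst hne; exact hi
    · exact hσ i' (Finset.mem_erase.2 ⟨hne, hi'⟩)
  · refine ⟨!σ j, fun i' hi' => ?_, hkeep _⟩
    by_cases hne : i' = i
    · subst hne; exact holds_blockVals_update_not (E i') σ hji hi
    · exact hothers _ i' hi' hne

/-- **Small sets of rows of an expander are satisfiable**: if the row supports form an
`(r, c)`-boundary expander with `c > 0`, every set `I` of at most `r` rows has a common solution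
(peel a boundary variable and flip it; BSW's argument, Krajíček's Lemma 13.4.4 in the safe-set
language). [cite: BenSassonWigderson2001, Thm 6.5] -/
theorem exists_rows_hold_of_card_le {n m : ℕ} (E : Fin m → LinEqMod 2 n) {r c : ℝ}
    (hexp : IsBoundaryExpander (fun i => (E i).supp.map Fin.valEmbedding) r c) (hc : 0 < c)
    (I : Finset (Fin m)) (hIr : (I.card : ℝ) ≤ r) :
    ∃ σ : ℕ → Bool, ∀ i ∈ I, (E i).Holds (blockVals 2 1 n σ) := by
  induction I using Finset.strongInduction with
  | H I ih =>
    rcases I.eq_empty_or_nonempty with rfl | hne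
    · exact ⟨fun _ => false, by simp⟩
    obtain ⟨x, hx⟩ := boundary_nonempty_of_isBoundaryExpander hexp hc hne hIr
    obtain ⟨i, hi, j, rfl, hji, huniq⟩ := exists_unique_row_of_mem_boundary E hx
    obtain ⟨σ, hσ⟩ := ih (I.erase i) (Finset.erase_ssubset hi)
      (le_trans (by exact_mod_cast Finset.card_le_card (Finset.erase_subset _ _)) hIr)
    obtain ⟨b, hb, -⟩ := exists_flip_row E hji huniq hσ
    exact ⟨_, hb⟩

/-- **Boundary variables of a minimal implying set of rows occur in the implied clause** (the
heart of BSW Thm 5.9, for parity constraints): if the rows of `I` imply `C` but no `I ∖ {i}`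
does, then `∂I ⊆ vars(C)`. [cite: BenSassonWigderson2001, Thm 5.9] -/
theorem boundary_subset_clauseVars_of_row_minimal {n m : ℕ} (E : Fin m → LinEqMod 2 n)
    {I : Finset (Fin m)} {C : Finset (Literal ℕ)}
    (hIC : ∀ σ : ℕ → Bool, (∀ i ∈ I, (E i).Holds (blockVals 2 1 n σ)) → finsetClauseEval σ C)
    (hmin : ∀ i ∈ I, ¬ ∀ σ : ℕ → Bool,
      (∀ i' ∈ I.erase i, (E i').Holds (blockVals 2 1 n σ)) → finsetClauseEval σ C) :
    boundary (fun i => (E i).supp.map Fin.valEmbedding) I ⊆ clauseVars C := by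
  intro x hx
  obtain ⟨i, hi, j, rfl, hji, huniq⟩ := exists_unique_row_of_mem_boundary E hx
  by_contra hxC
  have h := hmin i hi
  push Not at h
  obtain ⟨σ, hσ, hσC⟩ := h
  obtain ⟨b, hb, hkeep⟩ := exists_flip_row E hji huniq hσ
  exact hσC ((hkeep C hxC).1 (hIC _ hb))

/-! ### The width invariant for the XOR-CNF -/

/-- Every clause of the XOR-CNF `sumEncoding 1 E` belongs to the canonical CNF of some row `k`
and is therefore implied by the equation of row `k` alone (`μ ≤ 1` on axioms).
[cite: BenSassonWigderson2001, §5 (Lemma 5.2)] -/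
theorem exists_row_implies_of_mem_clauseSet {n m : ℕ} (E : Fin m → LinEqMod 2 n)
    {A : Finset (Literal ℕ)} (hA : A ∈ clauseSet (sumEncoding 1 E)) :
    ∃ k : Fin m, ∀ σ : ℕ → Bool, (E k).Holds (blockVals 2 1 n σ) → finsetClauseEval σ A := by
  obtain ⟨c, hc, rfl⟩ := mem_clauseSet_iff.1 hA
  simp only [sumEncoding, List.mem_flatMap, List.mem_finRange, true_and] at hc
  obtain ⟨k, hck⟩ := hc
  refine ⟨k, fun σ hσ => ?_⟩
  have hev : (equationCNF 1 (E k)).eval σ = true := by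
    rw [eval_equationCNF]
    exact decide_eq_true hσ
  have hcl : c.any (Literal.eval σ) = true := (CNF.eval_eq_true_iff _ _).1 hev c hck
  obtain ⟨l, hl, e⟩ := List.any_eq_true.1 hcl
  exact ⟨l, List.mem_toFinset.2 hl, e⟩

/-- **The width invariant** (BSW §5 — Lemmas 5.2, 5.4 and Thm 5.9 — for the rows of a linear
system over `𝔽₂`). If the row supports form an `(r, c)`-boundary expander with `c > 0`, `r ≥ 2`,
then every clause derivable from `sumEncoding 1 E` in width `w < c r / 2` is implied by the
equations of some set `I` of rows with `2|I| ≤ r`. [cite: BenSassonWigderson2001, Thm 5.9] -/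
theorem exists_rows_imply_of_resDerivable {n m : ℕ} (E : Fin m → LinEqMod 2 n) {r c : ℝ}
    (hexp : IsBoundaryExpander (fun i => (E i).supp.map Fin.valEmbedding) r c) (hc : 0 < c)
    (hr : 2 ≤ r) {w : ℕ} (hw : (w : ℝ) < c * r / 2) {C : Finset (Literal ℕ)}
    (hC : ResDerivable (clauseSet (sumEncoding 1 E)) w C) :
    ∃ I : Finset (Fin m), 2 * (I.card : ℝ) ≤ r ∧
      ∀ σ : ℕ → Bool, (∀ i ∈ I, (E i).Holds (blockVals 2 1 n σ)) → finsetClauseEval σ C := by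
  classical
  induction hC with
  | ax hA hAR _ =>
    obtain ⟨k, hk⟩ := exists_row_implies_of_mem_clauseSet E hA
    refine ⟨{k}, by simpa using hr, fun σ hσ => ?_⟩
    obtain ⟨l, hl, e⟩ := hk σ (hσ k (Finset.mem_singleton_self k))
    exact ⟨l, hAR hl, e⟩
  | @res C₁ C₂ R v b _ _ hv₁ hv₂ hsub hRw ih₁ ih₂ =>
    obtain ⟨I₁, hI₁, hI₁C⟩ := ih₁
    obtain ⟨I₂, hI₂, hI₂C⟩ := ih₂
    -- the union implies `R`
    have hU : ∀ σ : ℕ → Bool, (∀ i ∈ I₁ ∪ I₂, (E i).Holds (blockVals 2 1 n σ)) →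
        finsetClauseEval σ R := fun σ hσ =>
      finsetClauseEval_of_res (hI₁C σ fun i hi => hσ i (Finset.mem_union_left _ hi))
        (hI₂C σ fun i hi => hσ i (Finset.mem_union_right _ hi)) hsub
    have hUr : ((I₁ ∪ I₂).card : ℝ) ≤ r := by
      have h' : ((I₁ ∪ I₂).card : ℝ) ≤ I₁.card + I₂.card := by
        exact_mod_cast Finset.card_union_le I₁ I₂
      linarith
    -- a minimum-cardinality implying subset of the union
    obtain ⟨J, hJmem, hJmin⟩ := Finset.exists_min_image
      ((I₁ ∪ I₂).powerset.filter fun J => ∀ σ : ℕ → Bool,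
        (∀ i ∈ J, (E i).Holds (blockVals 2 1 n σ)) → finsetClauseEval σ R) Finset.card
      ⟨I₁ ∪ I₂, Finset.mem_filter.2 ⟨Finset.mem_powerset.2 subset_rfl, hU⟩⟩
    rw [Finset.mem_filter, Finset.mem_powerset] at hJmem
    obtain ⟨hJU, hJR⟩ := hJmem
    have hmin : ∀ i ∈ J, ¬ ∀ σ : ℕ → Bool,
        (∀ i' ∈ J.erase i, (E i').Holds (blockVals 2 1 n σ)) → finsetClauseEval σ R := by
      intro i hi himp
      have := hJmin (J.erase i) (Finset.mem_filter.2
        ⟨Finset.mem_powerset.2 ((Finset.erase_subset _ _).trans hJU), himp⟩)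
      rw [Finset.card_erase_of_mem hi] at this
      have := Finset.card_pos.2 ⟨i, hi⟩
      omega
    -- its boundary lies inside `vars(R)`, so it is small
    have hbd := boundary_subset_clauseVars_of_row_minimal E hJR hmin
    have hJr : (J.card : ℝ) ≤ r := le_trans (by exact_mod_cast Finset.card_le_card hJU) hUr
    have h1 : c * J.card ≤ ((boundary (fun i => (E i).supp.map Fin.valEmbedding) J).card : ℝ) :=
      hexp J hJr
    have h2 : ((boundary (fun i => (E i).supp.map Fin.valEmbedding) J).card : ℝ) ≤ w := by
      exact_mod_cast ((Finset.card_le_card hbd).trans (card_clauseVars_le R)).trans hRw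
    refine ⟨J, ?_, hJR⟩
    have h3 : c * J.card < c * r / 2 := by linarith
    have h4 : (J.card : ℝ) < r / 2 := by
      rw [mul_div_assoc] at h3
      exact lt_of_mul_lt_mul_left h3 hc.le
    linarith

/-- **Expansion ⇒ width** for XOR-CNFs (BSW Thm 4.4 / Thm 6.5 for linear equations mod 2): if the
row supports of `E` form an `(r, c)`-boundary expander with `c > 0`, `r ≥ 2`, the empty clause is
not derivable from `sumEncoding 1 E` in width `< c r / 2`.
[cite: BenSassonWigderson2001, Thm 6.5] -/
theorem not_resDerivable_empty_of_rows {n m : ℕ} (E : Fin m → LinEqMod 2 n) {r c : ℝ}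
    (hexp : IsBoundaryExpander (fun i => (E i).supp.map Fin.valEmbedding) r c) (hc : 0 < c)
    (hr : 2 ≤ r) {w : ℕ} (hw : (w : ℝ) < c * r / 2) :
    ¬ ResDerivable (clauseSet (sumEncoding 1 E)) w ∅ := by
  intro hD
  obtain ⟨I, hI, hIE⟩ := exists_rows_imply_of_resDerivable E hexp hc hr hw hD
  obtain ⟨σ, hσ⟩ := exists_rows_hold_of_card_le E hexp hc I
    (by linarith [(Nat.cast_nonneg I.card : (0 : ℝ) ≤ I.card)])
  obtain ⟨l, hl, -⟩ := hIE σ hσ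
  simp at hl

/-! ### Small cases and assembly -/

/-- A width-`0` derivation of the empty clause is an axiom download of the empty clause.
[folklore] -/
theorem empty_mem_of_resDerivable_zero {F : Set (Finset (Literal ℕ))} (h : ResDerivable F 0 ∅) :
    (∅ : Finset (Literal ℕ)) ∈ F := by
  cases h with
  | ax hA hAE _ => rwa [Finset.subset_empty.1 hAE] at hA
  | res hC _ hvC _ _ _ =>
    have h1 := hC.card_le
    have h2 := Finset.card_pos.2 ⟨_, hvC⟩
    omega

/-- Positive boundary expansion at a single row (`r ≥ 1`, `c > 0`) makes every row support
non-empty, so the empty clause is not a clause of `sumEncoding 1 E`. [folklore] -/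
theorem empty_notMem_clauseSet_of_expander {n m : ℕ} (E : Fin m → LinEqMod 2 n) {r c : ℝ}
    (hexp : IsBoundaryExpander (fun i => (E i).supp.map Fin.valEmbedding) r c) (hc : 0 < c)
    (hr : 1 ≤ r) : (∅ : Finset (Literal ℕ)) ∉ clauseSet (sumEncoding 1 E) := by
  intro h
  obtain ⟨cl, hcl, hce⟩ := mem_clauseSet_iff.1 h
  obtain rfl : cl = [] := List.toFinset_eq_empty_iff _ |>.1 hce
  simp only [sumEncoding, List.mem_flatMap, List.mem_finRange, true_and] at hcl
  obtain ⟨k, hk⟩ := hcl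
  have hlen : ([] : Clause ℕ).length = (eqVars 1 (E k)).length := length_of_mem_canonicalCNF hk
  rw [length_eqVars, List.length_nil, mul_one] at hlen
  have hpos : 0 < ((E k).supp.map Fin.valEmbedding).card := hexp.card_pos hc hr k
  rw [Finset.card_map] at hpos
  omega

/-- From a refutation `π` of `φ` in the tree's calculus to a derivation of the empty clause of
width `resWidth π` in BSW's calculus (the empty restriction of
`resDerivable_restrict_of_isResRefutation`). [cite: BenSassonWigderson2001, §2.2] -/
theorem resDerivable_empty_of_isResRefutation {φ : CNF ℕ} {π : List (ResLine ℕ)}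
    (hπ : IsResRefutation φ π) : ResDerivable (clauseSet φ) (resWidth π) ∅ := by
  have h := resDerivable_restrict_of_isResRefutation hπ (fun _ => none) (W := resWidth π)
    (fun l hl _ => by simpa using resWidth_le_iff.1 le_rfl l hl)
  simpa using h

/-- **Krajíček 2019, Lemma 13.4.5** (discharge of the named fact `Krajicek2019_lemma_13_4_5`):
for natural numbers `ℓ ≥ 1`, `r ≥ 1` and every system `E` of `m` linear equations over `𝔽₂` in
`n` unknowns whose row supports form an `(r, 3/4 · ℓ)`-boundary expander (Krajíček's
`(r, 3/4)`-expander for an `ℓ`-sparse matrix), every resolution refutation `π` of the XOR-CNF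
`sumEncoding 1 E` (`= ¬ τ_b̄(A)`) has `resWidth π ≥ r/4`. Proved by the Ben-Sasson–Wigderson
row-level width invariant (module docstring), which gives `3ℓr/8 ≥ r/4` for `r ≥ 2`, and by
`resWidth π ≥ 1` for `r = 1`; the sparsity and unsolvability hypotheses are not needed.
[cite: KrajicekProofComplexity2019, Lemma 13.4.5 (§13.4, p. 273)] -/
theorem Krajicek2019_lemma_13_4_5_holds : Krajicek2019_lemma_13_4_5 := by
  intro ℓ r n m E hℓ hr _ hexp _ π hπ
  have hD := resDerivable_empty_of_isResRefutation hπ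
  have h1 : (1 : ℝ) ≤ ℓ := by exact_mod_cast hℓ
  have hc : (0 : ℝ) < 3 / 4 * ℓ := by linarith
  have hr1 : (1 : ℝ) ≤ r := by exact_mod_cast hr
  rcases lt_or_ge r 2 with hr2 | hr2
  · -- `r = 1`: it suffices that the refutation contains a non-empty clause
    have hW1 : 1 ≤ resWidth π := by
      by_contra h0
      have h0' : resWidth π = 0 := by omega
      rw [h0'] at hD
      exact empty_notMem_clauseSet_of_expander E hexp hc hr1 (empty_mem_of_resDerivable_zero hD)
    have hreq : (r : ℝ) = 1 := by exact_mod_cast (show r = 1 by omega)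
    have hW1' : (1 : ℝ) ≤ resWidth π := by exact_mod_cast hW1
    rw [hreq]
    linarith
  · -- `r ≥ 2`: the Ben-Sasson–Wigderson invariant gives `3ℓr/8 ≤ resWidth π`
    have hr2' : (2 : ℝ) ≤ r := by exact_mod_cast hr2
    have hnot : ¬ ((resWidth π : ℝ) < 3 / 4 * ℓ * r / 2) := fun hlt =>
      not_resDerivable_empty_of_rows E hexp hc hr2' hlt hD
    push Not at hnot
    have hr0 : (0 : ℝ) ≤ r := by positivity
    nlinarith

end Literature.Computability.MetaComplexity
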